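import Summits.Schanuel.Schanuel.Theorems.ZilberEacParamCurveEscape
import Summits.Schanuel.Schanuel.Theorems.ZilberEacGraphCurveEscapePolyLemmas
import HarnessLib

/-!
# Polynomially parametrised base curves, IX-a: the stage roots on the ray, packaged

HONEST FRAMING.  Cell `pub-schanuel` (Zilber's Exponential-Algebraic Closedness, case ladder;
host summit Schanuel), seat 2, gen 19.  Over a polynomial curve `C = g(ℂ)` the surfaces of
Mantova–Masser's case need not be products: `W = {(g(t), y) : Q(t; y₀, y₁) = 0}` with the fibre
curve moving with the parameter.  Along `C`, `Q(t; e^{g₀(t)}, e^{g₁(t)}) = Σ_m c_m t^{m₀}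
e^{m₁ g₀(t) + m₂ g₁(t)}` is an exponential sum with POLYNOMIAL coefficients in `t`; this file ports
gen 16's engine with polynomial coefficients (`exists_escape_zeros_poly`) to the directional setting
of file III: `exists_escape_zeros_poly_dir`.  The density theorems built on it are instances of
Mantova–Masser's OPEN question (PLMS 2024, §1 p. 5); NOT Schanuel's conjecture (neither used nor
implied; EAC ⇏ SC); `EC(3,2)` stays OPEN.  THIS FILE packages the stage roots of file II with
the growth of the escape coordinate (`exists_ray_roots`) for the engine of file IX
(`ZilberEacParamCurveEscapePoly`).

THE ENGINE (file IX).  `R` of degree `d ≥ 2` with a root direction `ω` (`lc(R) ω^d = ±2πi`); `G` of degree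
`m ≥ 1` with `Re(lc(G) ω^m) < 0`; coefficients `q_j ∈ ℂ[t]` of degree `≤ n` whose top polynomial
`Σ_j [tⁿ]q_j X^{e_j}` is nonzero with a root `θ ≠ 0`; `E` entire with
`‖E(t)‖ ≤ C_B (1 + ‖t‖)^N e^{δ Re G(t)}` for `Re G(t) ≤ 0`, `|Re R(t)| ≤ B`.  Then
`Σ_j q_j(t) e^{e_j R(t)} + E(t)` has zeros `t_k` with `Re G(t_k) ≤ -L_k`, `‖G(t_k)‖ ≤ A L_k`,
`L_k → ∞`.  Proof = gen 16's (rescaling by `z₀ⁿ`, coefficient tails `≤ K_j/‖z₀‖`) with the stage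
roots ON the ray (file II) so that `Re G ≤ -(A₀/2)(k+1)^m` on the unit disc around them, which beats
the polynomial weight `(1 + ‖t‖)^N`.
-/

noncomputable section

open Filter Topology Metric Set Complex Polynomial
open Literature.ModelTheory.Zilber

set_option linter.dupNamespace false

namespace Summit.Schanuel.Schanuel.Theorems

/-- `x^N e^{-c x} → 0` (`c > 0`). -/
theorem tendsto_pow_mul_exp_neg_mul {c : ℝ} (hc : 0 < c) (N : ℕ) :
    Tendsto (fun x : ℝ => x ^ N * Real.exp (-(c * x))) atTop (𝓝 0) := by
  have h1 := (Real.tendsto_pow_mul_exp_neg_atTop_nhds_zero N).comp (tendsto_id.const_mul_atTop hc)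
  have h2 : Tendsto (fun x : ℝ => (c ^ N)⁻¹ * ((c * x) ^ N * Real.exp (-(c * x)))) atTop
      (𝓝 ((c ^ N)⁻¹ * 0)) := h1.const_mul _
  rw [mul_zero] at h2
  refine h2.congr fun x => ?_
  have hcN : c ^ N ≠ 0 := pow_ne_zero _ hc.ne'
  rw [mul_pow]; field_simp

/-! ## Part A. The stage roots on the ray, packaged -/

/-- **Stage roots on the ray.**  `deg R ≥ 2`, `lc(R) ω^{deg R} = 2πi s`; `deg G ≥ 1`,
`Re(lc(G) ω^{deg G}) < 0`; `c₀ ∈ ℂ`.  There are sizes `Λ_j, Λ'_j → ∞` (nonnegative, with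
`(2 + 3Λ_j)^N e^{-cΛ'_j} → 0` for all `N`, `c > 0`), a constant `A`, and exact roots `z₀(j)` of
`e^{R(z₀)} = e^{c₀}`, `Re R(z₀) = Re c₀`, with `1 ≤ ‖z₀‖`, `2 ≤ ‖lc R‖ ‖z₀‖`,
`Λ_j/3 ≤ ‖z₀‖ ≤ 3Λ_j`, and on the unit disc around `z₀(j)`: `Re G ≤ -Λ'_j`, `‖G‖ ≤ A Λ'_j`.
(new) -/
theorem exists_ray_roots (R G : Polynomial ℂ) (hd : 2 ≤ R.natDegree) (hm : 1 ≤ G.natDegree)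
    (ω : ℂ) (s : ℤ) (hs : s = 1 ∨ s = -1)
    (hω : R.leadingCoeff * ω ^ R.natDegree = 2 * Real.pi * I * s)
    (hdir : (G.leadingCoeff * ω ^ G.natDegree).re < 0) (c₀ : ℂ) :
    ∃ (z₀ : ℕ → ℂ) (Λ Λ' : ℕ → ℝ) (A : ℝ), Tendsto Λ atTop atTop ∧ Tendsto Λ' atTop atTop ∧
      (∀ j, 0 ≤ Λ j) ∧ (∀ j, 0 ≤ Λ' j) ∧
      (∀ (N : ℕ) (c : ℝ), 0 < c →
        Tendsto (fun j => (2 + 3 * Λ j) ^ N * Real.exp (-(c * Λ' j))) atTop (𝓝 0)) ∧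
      ∀ j, exp (R.eval (z₀ j)) = exp c₀ ∧ (R.eval (z₀ j)).re = c₀.re ∧ 1 ≤ ‖z₀ j‖ ∧
        2 ≤ ‖R.leadingCoeff‖ * ‖z₀ j‖ ∧ Λ j / 3 ≤ ‖z₀ j‖ ∧ ‖z₀ j‖ ≤ 3 * Λ j ∧
        (∀ z : ℂ, ‖z - z₀ j‖ ≤ 1 → (G.eval z).re ≤ -Λ' j ∧ ‖G.eval z‖ ≤ A * Λ' j) := by
  set d : ℕ := R.natDegree with hd_def
  set a : ℂ := R.leadingCoeff with ha_def
  set ℓ : Polynomial ℂ := R.eraseLead with hℓ_def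
  obtain ⟨m, hm_def⟩ : ∃ m : ℕ, m = G.natDegree := ⟨_, rfl⟩
  obtain ⟨b, hb_def⟩ : ∃ b : ℂ, b = G.leadingCoeff := ⟨_, rfl⟩
  rw [← hm_def, ← hb_def] at hdir
  rw [← hm_def] at hm
  have hd1 : 1 ≤ d := by omega
  have hR0 : R ≠ 0 := by
    rintro rfl
    rw [hd_def, Polynomial.natDegree_zero] at hd
    omega
  have ha0 : a ≠ 0 := Polynomial.leadingCoeff_ne_zero.2 hR0
  have hapos : 0 < ‖a‖ := norm_pos_iff.2 ha0
  have hrhs : (2 * Real.pi * I * s : ℂ) ≠ 0 := by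
    have hsC : (s : ℂ) ≠ 0 := by rcases hs with rfl | rfl <;> simp
    have hπ : (Real.pi : ℂ) ≠ 0 := Complex.ofReal_ne_zero.mpr Real.pi_pos.ne'
    simp [hsC, hπ, Complex.I_ne_zero]
  have hω0 : ω ≠ 0 := by
    rintro rfl
    rw [zero_pow (by omega), mul_zero] at hω
    exact hrhs hω.symm
  have hωpos : 0 < ‖ω‖ := norm_pos_iff.mpr hω0
  -- constants
  set C₁ : ℝ := coeffNormSum ℓ * (3 * ‖ω‖ + 1) ^ (d - 1) + ‖c₀‖ with hC₁
  have hC₁0 : 0 ≤ C₁ := by have := coeffNormSum_nonneg ℓ; positivity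
  set K₁ : ℝ := C₁ / Real.pi with hK₁
  set A₀ : ℝ := -(b * ω ^ m).re with hA₀_def
  have hA₀ : 0 < A₀ := by rw [hA₀_def]; linarith
  set K₂ : ℝ := 2 * m * K₁ * ‖b‖ * ‖ω‖ ^ m +
    (m * ‖b‖ + coeffNormSum G.eraseLead) * (3 * ‖ω‖ + 1) ^ (m - 1) with hK₂
  set K₃ : ℝ := coeffNormSum G * (3 * ‖ω‖ + 1) ^ m with hK₃
  have hK₃0 : 0 ≤ K₃ := by have := coeffNormSum_nonneg G; positivity
  -- eventual conditions
  have hk1 : Tendsto (fun k : ℕ => (k : ℝ) + 1) atTop atTop := tendsto_natCast_add_atTop 1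
  have hev₁ : ∀ᶠ k : ℕ in atTop, 32 * C₁ ≤ 2 * Real.pi * ((k : ℝ) + 1) :=
    (hk1.const_mul_atTop (by positivity : (0 : ℝ) < 2 * Real.pi)).eventually_ge_atTop _
  have hev₂ : ∀ᶠ k : ℕ in atTop, 3 ≤ ((k : ℝ) + 1) * ‖ω‖ :=
    (hk1.atTop_mul_const hωpos).eventually_ge_atTop 3
  have hev₃ : ∀ᶠ k : ℕ in atTop, 6 ≤ ‖a‖ * (((k : ℝ) + 1) * ‖ω‖) :=
    ((hk1.atTop_mul_const hωpos).const_mul_atTop hapos).eventually_ge_atTop 6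
  have hev₄ : ∀ᶠ k : ℕ in atTop, (m : ℝ) * K₁ ≤ (k : ℝ) + 1 := hk1.eventually_ge_atTop _
  have hev₅ : ∀ᶠ k : ℕ in atTop, 2 * K₂ ≤ A₀ * ((k : ℝ) + 1) :=
    (hk1.const_mul_atTop hA₀).eventually_ge_atTop _
  obtain ⟨K₀, hK₀⟩ := eventually_atTop.1 (hev₁.and (hev₂.and (hev₃.and (hev₄.and hev₅))))
  -- the roots at stage `j + K₀`
  have hroot : ∀ j : ℕ, ∃ z₀ : ℂ, exp (R.eval z₀) = exp c₀ ∧ (R.eval z₀).re = c₀.re ∧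
      1 ≤ ‖z₀‖ ∧ 2 ≤ ‖a‖ * ‖z₀‖ ∧ (((j + K₀ : ℕ) : ℝ) + 1) * ‖ω‖ / 3 ≤ ‖z₀‖ ∧
      ‖z₀‖ ≤ 3 * ((((j + K₀ : ℕ) : ℝ) + 1) * ‖ω‖) ∧
      (∀ z : ℂ, ‖z - z₀‖ ≤ 1 → (G.eval z).re ≤ -(A₀ / 2 * (((j + K₀ : ℕ) : ℝ) + 1) ^ m) ∧
        ‖G.eval z‖ ≤ K₃ * (((j + K₀ : ℕ) : ℝ) + 1) ^ m) := by
    intro j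
    obtain ⟨h1, h2, h3, h4, h5⟩ := hK₀ (j + K₀) (Nat.le_add_left _ _)
    obtain ⟨ζ, hζ, hζK, hz₀⟩ := exists_alRoot_dir R hd ω s hs hω c₀ (j + K₀)
      (by rw [← hd_def, ← hℓ_def, ← hC₁]; exact h1)
    rw [← hd_def, ← hℓ_def, ← hC₁] at hζK
    have hkk0 : (0 : ℝ) ≤ ((j + K₀ : ℕ) : ℝ) := Nat.cast_nonneg _
    have hkkpos : (0 : ℝ) < ((j + K₀ : ℕ) : ℝ) + 1 := by linarith
    have hζK' : ‖ζ‖ ≤ K₁ / (((j + K₀ : ℕ) : ℝ) + 1) := by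
      rw [hK₁, div_div]; exact hζK
    have hζm : (G.natDegree : ℝ) * ‖ζ‖ ≤ 1 := by
      rw [← hm_def]
      calc (m : ℝ) * ‖ζ‖ ≤ (m : ℝ) * (K₁ / (((j + K₀ : ℕ) : ℝ) + 1)) :=
            mul_le_mul_of_nonneg_left hζK' (Nat.cast_nonneg m)
        _ = (m : ℝ) * K₁ / (((j + K₀ : ℕ) : ℝ) + 1) := by ring
        _ ≤ 1 := by rw [div_le_one hkkpos]; exact h4
    obtain ⟨hup, hlow⟩ := norm_ray_point_bounds ω hd1 (j + K₀) hζ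
    refine ⟨(((j + K₀ : ℕ) : ℂ) + 1) * ω * exp (ζ / d), ?_, ?_, ?_, ?_, ?_, ?_, fun z hz => ⟨?_, ?_⟩⟩
    · rw [hz₀, Complex.exp_add, Complex.exp_int_mul_two_pi_mul_I, one_mul]
    · rw [hz₀, Complex.add_re, gce_re_intCast_mul_two_pi_I, zero_add]
    · push_cast at hlow h2 ⊢; linarith
    · push_cast at hlow h3 ⊢
      have := mul_le_mul_of_nonneg_left hlow hapos.le
      linarith
    · push_cast at hlow ⊢; linarith
    · push_cast at hup ⊢; linarith
    · have hmain := re_eval_near_ray_le G (hm_def ▸ hm) ω hd1 (K₁ := K₁) (j + K₀) hζ hζK' hζm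
        (by push_cast at hz ⊢; exact hz)
      rw [← hm_def, ← hb_def, ← hK₂] at hmain
      have hre : (b * ω ^ m).re = -A₀ := by rw [hA₀_def]; ring
      rw [hre] at hmain
      set kk : ℝ := ((j + K₀ : ℕ) : ℝ) + 1 with hkk
      have hkkm : kk ^ m = kk * kk ^ (m - 1) := by
        rw [← pow_succ', Nat.sub_add_cancel hm]
      have hpow0 : (0 : ℝ) ≤ kk ^ (m - 1) := by positivity
      have h5' : K₂ ≤ A₀ / 2 * kk := by linarith
      have hK₂le : K₂ * kk ^ (m - 1) ≤ (A₀ / 2 * kk) * kk ^ (m - 1) :=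
        mul_le_mul_of_nonneg_right h5' hpow0
      have e : (A₀ / 2 * kk) * kk ^ (m - 1) = A₀ / 2 * kk ^ m := by rw [hkkm]; ring
      linarith
    · have := norm_eval_near_ray_le G ω hd1 (j + K₀) hζ (by push_cast at hz ⊢; exact hz)
      rw [← hm_def, ← hK₃] at this
      exact this
  choose z₀ hz₀e hz₀re hz₀1 hz₀2 hz₀low hz₀up hz₀G using hroot
  -- the sizes
  set kk : ℕ → ℝ := fun j => ((j + K₀ : ℕ) : ℝ) + 1 with hkk_def
  have hkk : Tendsto kk atTop atTop := hk1.comp (tendsto_add_atTop_nat K₀)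
  have hkk1 : ∀ j, 1 ≤ kk j := fun j => by
    have : (0 : ℝ) ≤ ((j + K₀ : ℕ) : ℝ) := Nat.cast_nonneg _
    simp only [hkk_def]; linarith
  refine ⟨z₀, fun j => kk j * ‖ω‖, fun j => A₀ / 2 * kk j ^ m, K₃ / (A₀ / 2),
    hkk.atTop_mul_const hωpos,
    ((tendsto_pow_atTop (by omega : m ≠ 0)).comp hkk).const_mul_atTop (half_pos hA₀),
    fun j => by have := hkk1 j; positivity, fun j => by have := hkk1 j; positivity,
    fun N c hc => ?_,
    fun j => ⟨hz₀e j, hz₀re j, hz₀1 j, hz₀2 j, hz₀low j, hz₀up j,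
      fun z hz => ⟨(hz₀G j z hz).1, ?_⟩⟩⟩
  · -- `(2 + 3 kk‖ω‖)^N e^{-c (A₀/2) kk^m} ≤ (2 + 3‖ω‖)^N kk^N e^{-(cA₀/2) kk} → 0`
    have hc' : 0 < c * A₀ / 2 := by positivity
    have h0 := (tendsto_pow_mul_exp_neg_mul hc' N).comp hkk
    have h1 : Tendsto (fun j : ℕ => (2 + 3 * ‖ω‖) ^ N *
        (kk j ^ N * Real.exp (-(c * A₀ / 2 * kk j)))) atTop (𝓝 ((2 + 3 * ‖ω‖) ^ N * 0)) :=
      h0.const_mul _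
    rw [mul_zero] at h1
    refine squeeze_zero (fun j => by positivity) (fun j => ?_) h1
    have hbase : 2 + 3 * (kk j * ‖ω‖) ≤ (2 + 3 * ‖ω‖) * kk j := by
      nlinarith [norm_nonneg ω, hkk1 j]
    have hexp : Real.exp (-(c * (A₀ / 2 * kk j ^ m))) ≤ Real.exp (-(c * A₀ / 2 * kk j)) := by
      refine Real.exp_le_exp.2 (neg_le_neg ?_)
      have hp : kk j ≤ kk j ^ m := by
        calc kk j = kk j ^ 1 := (pow_one _).symm
          _ ≤ kk j ^ m := pow_le_pow_right₀ (hkk1 j) hm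
      nlinarith [hc, hA₀]
    calc (2 + 3 * (kk j * ‖ω‖)) ^ N * Real.exp (-(c * (A₀ / 2 * kk j ^ m)))
        ≤ ((2 + 3 * ‖ω‖) * kk j) ^ N * Real.exp (-(c * A₀ / 2 * kk j)) :=
          mul_le_mul (pow_le_pow_left₀ (by positivity) hbase N) hexp (Real.exp_nonneg _)
            (by positivity)
      _ = (2 + 3 * ‖ω‖) ^ N * (kk j ^ N * Real.exp (-(c * A₀ / 2 * kk j))) := by
          rw [mul_pow]; ring
  · refine (hz₀G j z hz).2.trans (le_of_eq ?_)
    simp only [hkk_def]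
    field_simp


end Summit.Schanuel.Schanuel.Theorems
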